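import Summits.ResolutionOfSingularities.ResolutionOfSingularities.Theorems.EquisingularLiftEquisingularLiftNatHomRankOneClass
import Summits.ResolutionOfSingularities.ResolutionOfSingularities.Theorems.EquisingularLiftEquisingularLiftNatDirZeroDefs
import Literature.AlgebraicGeometry.Modules.LineBundleOfCocycleClass
import Literature.AlgebraicGeometry.Modules.UnitCocyclePullback
import HarnessLib

/-!
# [OURS · L1 W4.5(b) · S6 (L) brick C2, B3 plumbing] Cocycle-class bookkeeping for the Euler identification:
# `(f ≫ g)^* = f^* ∘ g^*` and `𝟙^* = id` on `Ȟ¹(–, 𝒪^×)`, the unit class, `[E^∨] = [E]⁻¹`, and the iso `ℙ¹_k ≅ Γ̃₁`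

Cell `res-hironaka`, LADDER-RESOLUTION rung L (D-0089), slot W4.5(b), crux chain w45b: working crux
`Theses.EquisingularLift.EquisingularLiftNat` (stmt-ResolutionOfSingularities-20038) / child `EquisingularLiftNatThree`
(stmt-ResolutionOfSingularities-20148); brick C2 of res-L1-w45b-stub-4's `Tower.hLift_of_bricks` (socket `stub_elnat_three_liftSections`),
B3 side of res-type-027's cut (`Cruxes/EquisingularLiftNatThree/Lines/C2-CENSUS-res-type-027.md` §1: `[𝒩] = [𝒞]⁻¹ = δ₁^*(det M̄/ū²)`,
`ψ^*[det M̄/ū²] = [F]·[L₀]⁻²`, «Close»), context-free pieces in the Čech / cocycle / pushforward-iso lane of res-L1-w45b-stub-2 g9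
(desk roster STATUS l.77572). `--supports stmt-ResolutionOfSingularities-20148 --as helper`. OURS; NOT a statement of any manuscript;
AI-written, and AI review is weaker than expert review. No `sorry`, standard axioms, DEF-FREE.

WHAT.
* `unitCocycle_pullback_comp_equiv`, **`cechPic_pullback_comp`** — `(f ≫ g)^* x = f^* (g^* x)` on `CechPic` (the functoriality left out of
  `Modules/UnitCocyclePullback` «deliberately not here»); `unitCocycle_pullback_id_equiv`, **`cechPic_pullback_id`** — `(𝟙 X)^* x = x`;
  `cechPic_pullback_inv_hom_apply`, `cechPic_pullback_hom_inv_apply`, `cechPic_pullback_congr` — bookkeeping along an isomorphism /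
  equal morphisms (B3 moves classes along `Φ = ψ ≫ (V(Ī) = Z̃₀) ≫ δ₁⁻¹`).
* `exists_frameSystem_unitModule` — the structure sheaf carries a rank-one frame system (frame `freePUnitIso ⊤` at every point) with class
  `1`; `isFiniteLocallyFree_unitModule`, `hasRank_unitModule_one`, **`detClass_unitModule`** (`[𝒪] = 1`).
* `isFiniteLocallyFree_dual_of_hasRank_one`, **`hasRank_dual_one`**, **`detClass_dual_eq_inv`** — `[E^∨] = [E]⁻¹` for `E` of rank one
  (K1 `detClass_sheafHom_of_hasRank_one` with `Q = 𝒪`; `dual E = 𝓗om(E, 𝒪)`): the step `[𝒩] = [𝒞]⁻¹` of the census.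
* **`exists_iso_redSub_of_subscheme_eq`** — the scheme isomorphism `Φ : Y ≅ Γ̃₁` assembled from G1's `ψ : Y ⟶ V(Ī)` (`IsIso`), the equality
  of ideal sheaves `Ī = 𝓘⟨Z₀⟩` (`hĪ`) and the section `δ₁ : Γ̃₁ ⟶ Z̃₀` (`IsIso`, over `υ₁`), WITH the squares B3 needs:
  `Φ.hom ≫ ι_{Γ₁} ≫ υ₁ = ψ ≫ ι_Ī` and `(Φ.hom ≫ δ₁) ≫ ι_{Z₀} = ψ ≫ ι_Ī` (so sections over `W ⊆ G₀` pull back to `Y` the same way through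
  either leg: `Scheme.Hom.appLE` along equal morphisms).

References (index only): R. Hartshorne, *Algebraic Geometry* (1977), III Ex. 4.5, II Ex. 6.8 (`f^*` on `Pic`), II Ex. 5.1 (b) (`E^∨` of a
line bundle) [cite: Hartshorne1977]; The Stacks Project, Tag 01ED [cite: StacksProject].
-/

noncomputable section

-- `TopCat.Presheaf`/`Scheme.Modules` are not reducible (as in Mathlib's `AlgebraicGeometry/Modules`).
set_option backward.isDefEq.respectTransparency false

open CategoryTheory AlgebraicGeometry TopologicalSpace Opposite
open Literature.AlgebraicGeometry.Modules Literature.AlgebraicGeometry.Motives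

set_option linter.dupNamespace false -- mandated namespace `Summit.<Summit>.<Problem>` of this single-conjunct summit

namespace Summit.ResolutionOfSingularities.ResolutionOfSingularities.Cruxes.EquisingularLiftNat.Sections

universe u

/-! ### Functoriality of `CechPic.pullback` -/

section PullbackFunctoriality

variable {X Y Z : Scheme.{u}}

/-- Pull-back of a cocycle of units along a composite is (cohomologous to, in fact equal to) the iterated pull-back: same opens
`(f ≫ g)⁻¹U_{g f x} = f⁻¹ g⁻¹ U_{g f x}`, same units `(f ≫ g)♯ = f♯ ∘ g♯` (Mathlib `Scheme.Hom.appLE_comp_appLE`). [folklore] -/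
theorem unitCocycle_pullback_comp_equiv (f : X ⟶ Y) (g : Y ⟶ Z) (c : UnitCocycle Z) :
    UnitCocycle.Equiv (UnitCocycle.pullback (f ≫ g) c) (UnitCocycle.pullback f (UnitCocycle.pullback g c)) := by
  refine UnitCocycle.equiv_of_eq _ _ (fun x => f ⁻¹ᵁ (g ⁻¹ᵁ c.U (g.base (f.base x)))) (fun x => c.mem (g.base (f.base x)))
    (fun x => le_of_eq rfl) (fun x => le_rfl) fun x y V hx hy => ?_
  change (g.appLE _ _ _ ≫ f.appLE _ V _) (c.g _ _ _ _ _) = (f ≫ g).appLE _ V _ (c.g _ _ _ _ _)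
  rw [Scheme.Hom.appLE_comp_appLE]
  rfl

/-- **`(f ≫ g)^* = f^* ∘ g^*` on `Ȟ¹(–, 𝒪^×)`.** [cite: Hartshorne1977, II Ex. 6.8 (functoriality of f^* on Pic)] -/
theorem cechPic_pullback_comp (f : X ⟶ Y) (g : Y ⟶ Z) (x : CechPic Z) :
    CechPic.pullback (f ≫ g) x = CechPic.pullback f (CechPic.pullback g x) := by
  obtain ⟨c, rfl⟩ := CechPic.mk_surjective x
  rw [CechPic.pullback_mk, CechPic.pullback_mk, CechPic.pullback_mk]
  exact CechPic.sound (unitCocycle_pullback_comp_equiv f g c)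

/-- Pull-back of a cocycle along the identity is (cohomologous to) the cocycle. [folklore] -/
theorem unitCocycle_pullback_id_equiv (c : UnitCocycle X) :
    UnitCocycle.Equiv (UnitCocycle.pullback (𝟙 X) c) c := by
  refine UnitCocycle.equiv_of_eq _ _ c.U c.mem (fun x => le_of_eq (Opens.map_id_obj _).symm) (fun x => le_rfl)
    fun x y V hx hy => ?_
  change c.g x y V _ _ = (𝟙 X : X ⟶ X).appLE _ V _ (c.g _ _ _ _ _)
  rw [Scheme.Hom.appLE, Scheme.Hom.id_app, Category.id_comp]
  exact (c.map_g x y inf_le_left inf_le_right (le_inf hx hy : V ≤ c.U x ⊓ c.U y)).symm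

/-- **`(𝟙 X)^* = id` on `Ȟ¹(X, 𝒪_X^×)`.** [cite: Hartshorne1977, II Ex. 6.8 (functoriality of f^* on Pic)] -/
theorem cechPic_pullback_id (x : CechPic X) : CechPic.pullback (𝟙 X) x = x := by
  obtain ⟨c, rfl⟩ := CechPic.mk_surjective x
  rw [CechPic.pullback_mk]
  exact CechPic.sound (unitCocycle_pullback_id_equiv c)

/-- Pull-backs along equal morphisms agree. [folklore] -/
theorem cechPic_pullback_congr {f f' : X ⟶ Y} (h : f = f') (x : CechPic Y) :
    CechPic.pullback f x = CechPic.pullback f' x := by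
  subst h; rfl

/-- Along an isomorphism `e : X ≅ Y`: `(e⁻¹)^* (e^* y) = y`. [folklore] -/
theorem cechPic_pullback_inv_hom_apply (e : X ≅ Y) (y : CechPic Y) :
    CechPic.pullback e.inv (CechPic.pullback e.hom y) = y := by
  rw [← cechPic_pullback_comp, e.inv_hom_id, cechPic_pullback_id]

/-- Along an isomorphism `e : X ≅ Y`: `e^* ((e⁻¹)^* x) = x`. [folklore] -/
theorem cechPic_pullback_hom_inv_apply (e : X ≅ Y) (x : CechPic X) :
    CechPic.pullback e.hom (CechPic.pullback e.inv x) = x := by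
  rw [← cechPic_pullback_comp, e.hom_inv_id, cechPic_pullback_id]

/-- Along an isomorphism `e : X ≅ Y`, `e^*` is injective on classes. [folklore] -/
theorem cechPic_pullback_injective_of_iso (e : X ≅ Y) : Function.Injective (CechPic.pullback e.hom) := by
  intro y y' h
  rw [← cechPic_pullback_inv_hom_apply e y, ← cechPic_pullback_inv_hom_apply e y', h]

end PullbackFunctoriality

/-! ### The unit class and the class of a dual -/

section UnitAndDual

variable {X : Scheme.{u}}

/-- **The structure sheaf has a rank-one frame system with trivial class**: frame `𝒪^{PUnit} ≅ 𝒪|_⊤` (tree `freePUnitIso`) at every point,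
all transition determinants `1`. [folklore] -/
theorem exists_frameSystem_unitModule :
    ∃ F : FrameSystem (unitModule X), (∀ x, F.rank x = 1) ∧ CechPic.mk F.cocycle = 1 := by
  let F : FrameSystem (unitModule X) :=
    { U := fun _ => ⊤
      mem := fun _ => trivial
      I := fun _ => PUnit
      rank := fun _ => 1
      enum := fun _ => Equiv.ofUnique PUnit (Fin 1)
      frame := fun _ => freePUnitIso ⊤ }
  refine ⟨F, fun _ => rfl, ?_⟩
  rw [← CechPic.mk_one]
  refine CechPic.sound (UnitCocycle.equiv_of_eq _ _ (fun _ => ⊤) (fun _ => trivial) (fun _ => le_rfl) (fun _ => le_rfl)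
    fun x y V hx hy => ?_)
  exact (transitionDet_self (E := unitModule X) (freePUnitIso ⊤) (Equiv.ofUnique PUnit (Fin 1)) (homOfLE hx)).symm

/-- The structure sheaf is finite locally free. [folklore] -/
theorem isFiniteLocallyFree_unitModule : IsFiniteLocallyFree (unitModule X) := by
  obtain ⟨F, -, -⟩ := exists_frameSystem_unitModule (X := X)
  exact F.isFiniteLocallyFree

/-- The structure sheaf has rank one. [folklore] -/
theorem hasRank_unitModule_one : HasRank (unitModule X) 1 := by
  obtain ⟨F, hF, -⟩ := exists_frameSystem_unitModule (X := X)
  exact F.hasRank 1 hF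

/-- **`[𝒪_X] = 1` in `Ȟ¹(X, 𝒪_X^×)`.** [cite: Hartshorne1977, III Ex. 4.5] -/
theorem detClass_unitModule (h : IsFiniteLocallyFree (unitModule X)) : detClass h = 1 := by
  obtain ⟨F, -, hF⟩ := exists_frameSystem_unitModule (X := X)
  rw [detClass_eq_mk h F, hF]

/-- The dual of a rank-one module is finite locally free. [folklore] -/
theorem isFiniteLocallyFree_dual_of_hasRank_one {E : X.Modules} (hE : HasRank E 1) : IsFiniteLocallyFree (dual E) :=
  isFiniteLocallyFree_sheafHom_of_hasRank_one hE hasRank_unitModule_one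

/-- **The dual of a rank-one module has rank one and class `[E^∨] = [E]⁻¹`** (`E^∨ = 𝓗om(E, 𝒪)`, K1 with `[𝒪] = 1`).
[cite: Hartshorne1977, II Ex. 5.1 (b) and III Ex. 4.5] -/
theorem detClass_dual_eq_inv {E : X.Modules} (hE : HasRank E 1) (hEf : IsFiniteLocallyFree E) (hDf : IsFiniteLocallyFree (dual E)) :
    HasRank (dual E) 1 ∧ detClass hDf = (detClass hEf)⁻¹ := by
  obtain ⟨h1, h2⟩ := detClass_sheafHom_of_hasRank_one hE hasRank_unitModule_one hEf isFiniteLocallyFree_unitModule hDf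
  exact ⟨h1, by rw [h2, detClass_unitModule, one_mul]⟩

/-- The dual of a rank-one module has rank one. [folklore] -/
theorem hasRank_dual_one {E : X.Modules} (hE : HasRank E 1) : HasRank (dual E) 1 := by
  obtain ⟨F, hF⟩ := exists_frameSystem_of_hasRank hE
  exact (detClass_dual_eq_inv hE F.isFiniteLocallyFree (isFiniteLocallyFree_dual_of_hasRank_one hE)).1

end UnitAndDual

/-! ### The scheme isomorphism `Y ≅ Γ̃₁` of brick C2 with its two squares -/

/-- **The iso `Φ : Y ≅ Γ̃₁` of the Euler identification, with its squares.** From G1's `ψ : Y ⟶ V(Ī)` (an isomorphism; `Y = ℙ¹_k`), the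
equality of ideal sheaves `Ī = 𝓘⟨Z₀⟩` on `G₀` (`hĪ`, so `V(Ī)` and the reduced `Z̃₀` are the same closed subscheme) and the section
`δ₁ : Γ̃₁ ⟶ Z̃₀` of the round (`δ₁ ≫ ι_{Z₀} = ι_{Γ₁} ≫ υ₁`, an isomorphism): an isomorphism `Φ : Y ≅ Γ̃₁` with
`Φ ≫ ι_{Γ₁} ≫ υ₁ = ψ ≫ ι_Ī` and `(Φ ≫ δ₁) ≫ ι_{Z₀} = ψ ≫ ι_Ī`. [OURS · C2/B3 plumbing; folklore] -/
theorem exists_iso_redSub_of_subscheme_eq {Y G₀ G₁ : Scheme.{0}} (Ī : G₀.IdealSheafData) (Z₀ : Set G₀) (hZ₀ : IsClosed Z₀)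
    (hĪ : Ī = Scheme.IdealSheafData.vanishingIdeal (⟨Z₀, hZ₀⟩ : Closeds G₀))
    (ψ : Y ⟶ Ī.subscheme) [IsIso ψ]
    (υ₁ : G₁ ⟶ G₀) (Γ₁ : Set G₁) (hΓ₁ : IsClosed Γ₁)
    (δ₁ : redSub G₁ Γ₁ hΓ₁ ⟶ redSub G₀ Z₀ hZ₀) (hδ₁ : δ₁ ≫ redSubι G₀ Z₀ hZ₀ = redSubι G₁ Γ₁ hΓ₁ ≫ υ₁) [IsIso δ₁] :
    ∃ Φ : Y ≅ redSub G₁ Γ₁ hΓ₁, Φ.hom ≫ redSubι G₁ Γ₁ hΓ₁ ≫ υ₁ = ψ ≫ Ī.subschemeι ∧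
      (Φ.hom ≫ δ₁) ≫ redSubι G₀ Z₀ hZ₀ = ψ ≫ Ī.subschemeι := by
  -- `V(Ī) ⟶ Z̃₀`, the inclusion of subschemes along `𝓘⟨Z₀⟩ ≤ Ī` (an equality), over `G₀`
  let κ : Ī.subscheme ⟶ redSub G₀ Z₀ hZ₀ := Scheme.IdealSheafData.inclusion hĪ.ge
  have hκ : κ ≫ redSubι G₀ Z₀ hZ₀ = Ī.subschemeι := Scheme.IdealSheafData.inclusion_subschemeι hĪ.ge
  haveI : IsIso κ := by
    refine ⟨⟨Scheme.IdealSheafData.inclusion hĪ.le, ?_, ?_⟩⟩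
    · rw [Scheme.IdealSheafData.inclusion_comp, Scheme.IdealSheafData.inclusion_id]
    · rw [Scheme.IdealSheafData.inclusion_comp, Scheme.IdealSheafData.inclusion_id]
  refine ⟨asIso ψ ≪≫ asIso κ ≪≫ (asIso δ₁).symm, ?_, ?_⟩
  · change (ψ ≫ κ ≫ inv δ₁) ≫ redSubι G₁ Γ₁ hΓ₁ ≫ υ₁ = _
    rw [Category.assoc, Category.assoc, ← hδ₁, IsIso.inv_hom_id_assoc, hκ]
  · change ((ψ ≫ κ ≫ inv δ₁) ≫ δ₁) ≫ redSubι G₀ Z₀ hZ₀ = _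
    rw [Category.assoc, Category.assoc, Category.assoc, IsIso.inv_hom_id_assoc, hκ]

end Summit.ResolutionOfSingularities.ResolutionOfSingularities.Cruxes.EquisingularLiftNat.Sections

end
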